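import Summits.BirchSwinnertonDyer.BirchSwinnertonDyer.Theorems.ResidualThetaTransportAtTwoHeckeThetaPartnerAdicAtTwoThetaClassCount
import HarnessLib

/-!
# The weighted class-representative count (toward K0⁺, stmt-20690)

Route `ResidualThetaTransportAtTwo`, crux K0⁺ `HeckeThetaPartnerAdicAtTwo` (stmt-BirchSwinnertonDyer-20690),
line "Hecke theta series from the genus-two Riemann theta function".  THEOREMS ONLY.

Weighted form of `ThetaClassCount.sum_natCard_norm_eq`: for class representatives `𝔞_c` and a
weight `h(c, x)` depending only on the ideal `𝔟` with `(x) = 𝔞_c 𝔟` (through `g(𝔟)`),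
`Σ_c Σ_{x ∈ 𝔞_c, N((x)) = n N𝔞_c} h(c, x) = #𝓞_K^× · Σ_{N𝔟 = n} g(𝔟)` (`n ≥ 1`): the map
`(c, x) ↦ 𝔟` is onto the ideals of norm `n` with fibres the `#𝓞_K^×` generators of `𝔞_c 𝔟`.
This is the bookkeeping behind `a_n(θ_ψ) = Σ_{N𝔟 = n} ψ̃(𝔟)` (Hecke 1926).

BSD is not proved by this file.
-/

set_option autoImplicit false
set_option linter.dupNamespace false

noncomputable section

open scoped NumberField nonZeroDivisors
open NumberField Module IsDedekindDomain

namespace Summit.BirchSwinnertonDyer.BirchSwinnertonDyer.Theorems.HeckeTheta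

open Literature.NumberTheory.LFunctions (idealNormCount)

variable {K : Type} [Field K] [NumberField K]

/-- `x ∈ 𝔞 ≠ 0` gives `(x) = 𝔞 𝔟` for a unique `𝔟`. -/
theorem exists_unique_ideal_eq_mul {𝔞 : Ideal (𝓞 K)} (h𝔞 : 𝔞 ≠ ⊥) {x : 𝓞 K} (hx : x ∈ 𝔞) :
    ∃! 𝔟 : Ideal (𝓞 K), Ideal.span {x} = 𝔞 * 𝔟 := by
  obtain ⟨𝔟, h𝔟⟩ : 𝔞 ∣ Ideal.span {x} := Ideal.dvd_iff_le.mpr ((Ideal.span_singleton_le_iff_mem _).mpr hx)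
  exact ⟨𝔟, h𝔟, fun 𝔟' h𝔟' => mul_left_cancel₀ h𝔞 (h𝔟'.symm.trans h𝔟)⟩

/-- **The weighted class-representative count.**  `Σ_c Σ_{x ∈ 𝔞_c, N((x)) = n N𝔞_c} h(c,x) =
#𝓞_K^× · Σ_{N𝔟 = n} g(𝔟)` whenever `h(c, x) = g(𝔟)` for `(x) = 𝔞_c 𝔟` (`n ≥ 1`). -/
theorem sum_weighted_norm_eq (hK : finrank ℚ K = 2) [IsTotallyComplex K]
    (𝔞 : ClassGroup (𝓞 K) → (Ideal (𝓞 K))⁰) (h𝔞 : ∀ c, ClassGroup.mk0 (𝔞 c) = c)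
    {n : ℕ} (hn : n ≠ 0) (g : Ideal (𝓞 K) → ℂ) (h : ClassGroup (𝓞 K) → 𝓞 K → ℂ)
    (hh : ∀ c (x : 𝓞 K) (J : Ideal (𝓞 K)), x ∈ (𝔞 c : Ideal (𝓞 K)) →
      Ideal.span {x} = (𝔞 c : Ideal (𝓞 K)) * J → h c x = g J) :
    ∑ c : ClassGroup (𝓞 K), ∑ᶠ x : {x : 𝓞 K // x ∈ (𝔞 c : Ideal (𝓞 K)) ∧
        Ideal.absNorm (Ideal.span {x}) = n * Ideal.absNorm (𝔞 c : Ideal (𝓞 K))}, h c x.1 =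
      Nat.card (𝓞 K)ˣ * ∑ᶠ J : {J : Ideal (𝓞 K) // Ideal.absNorm J = n}, g J.1 := by
  classical
  haveI : Finite (𝓞 K)ˣ := finite_units hK
  have h𝔞0 : ∀ c, (𝔞 c : Ideal (𝓞 K)) ≠ ⊥ := fun c => nonZeroDivisors.coe_ne_zero (𝔞 c)
  have h𝔞N : ∀ c, Ideal.absNorm (𝔞 c : Ideal (𝓞 K)) ≠ 0 := fun c => by
    rw [Ne, Ideal.absNorm_eq_zero_iff]; exact h𝔞0 c
  set D := {p : ClassGroup (𝓞 K) × 𝓞 K // p.2 ∈ (𝔞 p.1 : Ideal (𝓞 K)) ∧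
    Ideal.absNorm (Ideal.span {p.2}) = n * Ideal.absNorm (𝔞 p.1 : Ideal (𝓞 K))} with hD
  set T := {J : Ideal (𝓞 K) // Ideal.absNorm J = n} with hT
  haveI : Finite T := (Ideal.finite_setOf_absNorm_eq (S := 𝓞 K) n).to_subtype
  letI : Fintype T := Fintype.ofFinite T
  have hquot : ∀ p : D, ∃! J : Ideal (𝓞 K), Ideal.span {p.1.2} = (𝔞 p.1.1 : Ideal (𝓞 K)) * J :=
    fun p => exists_unique_ideal_eq_mul (h𝔞0 p.1.1) p.2.1
  have hquotN : ∀ p : D, ∀ J : Ideal (𝓞 K), Ideal.span {p.1.2} = (𝔞 p.1.1 : Ideal (𝓞 K)) * J →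
      Ideal.absNorm J = n := by
    intro p J hJ
    have h := p.2.2
    rw [hJ, map_mul, mul_comm] at h
    exact mul_right_cancel₀ (h𝔞N p.1.1) h
  set f : D → T := fun p => ⟨(hquot p).choose, hquotN p _ (hquot p).choose_spec.1⟩ with hf
  have hf_spec : ∀ p : D, Ideal.span {p.1.2} = (𝔞 p.1.1 : Ideal (𝓞 K)) * (f p : Ideal (𝓞 K)) :=
    fun p => (hquot p).choose_spec.1
  have hf_eq : ∀ (p : D) (J : Ideal (𝓞 K)), Ideal.span {p.1.2} = (𝔞 p.1.1 : Ideal (𝓞 K)) * J →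
      (f p : Ideal (𝓞 K)) = J := fun p J hJ => ((hquot p).unique (hf_spec p) hJ)
  have hJ0 : ∀ J : T, (J : Ideal (𝓞 K)) ∈ (Ideal (𝓞 K))⁰ := fun J =>
    mem_nonZeroDivisors_of_ne_zero (by
      intro h0; have := J.2; rw [h0, Ideal.zero_eq_bot, Ideal.absNorm_bot] at this; exact hn this.symm)
  set cl : T → ClassGroup (𝓞 K) := fun J => (ClassGroup.mk0 ⟨(J : Ideal (𝓞 K)), hJ0 J⟩)⁻¹ with hcl
  have hclass : ∀ p : D, p.1.1 = cl (f p) := by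
    intro p
    rw [hcl]
    simp only
    rw [← h𝔞 p.1.1, ClassGroup.mk0_eq_mk0_inv_iff]
    refine ⟨p.1.2, ?_, (hf_spec p).symm⟩
    intro h0
    have := p.2.2
    rw [h0, Ideal.span_singleton_zero] at this
    simp only [Ideal.absNorm_bot] at this
    exact absurd this.symm (mul_ne_zero hn (h𝔞N p.1.1))
  have hprinc : ∀ J : T, ∃ x : 𝓞 K, x ≠ 0 ∧
      (𝔞 (cl J) : Ideal (𝓞 K)) * (J : Ideal (𝓞 K)) = Ideal.span {x} := by
    intro J
    have h := (ClassGroup.mk0_eq_mk0_inv_iff (I := 𝔞 (cl J)) (J := ⟨(J : Ideal (𝓞 K)), hJ0 J⟩)).mp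
      (by rw [h𝔞])
    obtain ⟨x, hx, h'⟩ := h
    exact ⟨x, hx, h'⟩
  have hfibre : ∀ J : T, Nat.card {p : D // f p = J} = Nat.card (𝓞 K)ˣ := by
    intro J
    obtain ⟨x₀, hx₀, hx₀J⟩ := hprinc J
    rw [← natCard_generators_eq hx₀]
    have hg : ∀ q : {p : D // f p = J}, Ideal.span {q.1.1.2} = Ideal.span {x₀} := by
      intro q
      have h1 := hf_spec q.1
      have h2 : ((f q.1 : T) : Ideal (𝓞 K)) = (J : Ideal (𝓞 K)) := congrArg Subtype.val q.2
      have h3 : q.1.1.1 = cl J := by rw [hclass q.1]; exact congrArg cl q.2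
      rw [h2, h3, hx₀J] at h1
      exact h1
    refine Nat.card_congr (Equiv.ofBijective
      (fun q : {p : D // f p = J} => (⟨q.1.1.2, hg q⟩ : {x : 𝓞 K // Ideal.span {x} = Ideal.span {x₀}}))
      ⟨?_, ?_⟩)
    · intro q q' hqq'
      have hx : q.1.1.2 = q'.1.1.2 := congrArg Subtype.val hqq'
      have hc : q.1.1.1 = q'.1.1.1 := by
        rw [hclass q.1, hclass q'.1]
        exact congrArg cl (q.2.trans q'.2.symm)
      apply Subtype.ext; apply Subtype.ext
      exact Prod.ext hc hx
    · rintro ⟨y, hy⟩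
      have hyJ : Ideal.span {y} = (𝔞 (cl J) : Ideal (𝓞 K)) * (J : Ideal (𝓞 K)) := hy.trans hx₀J.symm
      have hymem : y ∈ (𝔞 (cl J) : Ideal (𝓞 K)) :=
        (Ideal.span_singleton_le_iff_mem _).mp (by rw [hyJ]; exact Ideal.mul_le_right)
      have hyN : Ideal.absNorm (Ideal.span {y}) = n * Ideal.absNorm (𝔞 (cl J) : Ideal (𝓞 K)) := by
        rw [hyJ, map_mul, J.2, mul_comm]
      let p : D := ⟨(cl J, y), hymem, hyN⟩
      have hfp : f p = J := Subtype.ext (hf_eq p _ hyJ)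
      exact ⟨⟨p, hfp⟩, rfl⟩
  have hw0 : Nat.card (𝓞 K)ˣ ≠ 0 := Nat.card_pos.ne'
  haveI hfibfin : ∀ J : T, Finite {p : D // f p = J} := fun J =>
    Nat.finite_of_card_ne_zero (by rw [hfibre J]; exact hw0)
  haveI : Finite D := by
    rw [(Equiv.sigmaFiberEquiv f).symm.finite_iff]; infer_instance
  letI : Fintype D := Fintype.ofFinite D
  letI : ∀ J : T, Fintype {p : D // f p = J} := fun J => Fintype.ofFinite _
  haveI : ∀ c : ClassGroup (𝓞 K), Finite {x : 𝓞 K // x ∈ (𝔞 c : Ideal (𝓞 K)) ∧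
      Ideal.absNorm (Ideal.span {x}) = n * Ideal.absNorm (𝔞 c : Ideal (𝓞 K))} := fun c =>
    Finite.of_injective (fun x => (⟨(c, x.1), x.2⟩ : D)) fun x x' h => by
      apply Subtype.ext
      have := congrArg (fun p : D => p.1.2) h
      exact this
  letI : ∀ c : ClassGroup (𝓞 K), Fintype {x : 𝓞 K // x ∈ (𝔞 c : Ideal (𝓞 K)) ∧
      Ideal.absNorm (Ideal.span {x}) = n * Ideal.absNorm (𝔞 c : Ideal (𝓞 K))} := fun c => Fintype.ofFinite _
  -- the weight on `D` depends only on `f p`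
  have hweight : ∀ p : D, h p.1.1 p.1.2 = g (f p : Ideal (𝓞 K)) := fun p => hh _ _ _ p.2.1 (hf_spec p)
  -- `Σ_c Σ_{X_c} = Σ_D = Σ_T Σ_fibre = w Σ_T`
  have hLHS : ∑ c : ClassGroup (𝓞 K), ∑ᶠ x : {x : 𝓞 K // x ∈ (𝔞 c : Ideal (𝓞 K)) ∧
        Ideal.absNorm (Ideal.span {x}) = n * Ideal.absNorm (𝔞 c : Ideal (𝓞 K))}, h c x.1 =
      ∑ p : D, h p.1.1 p.1.2 := by
    simp only [finsum_eq_sum_of_fintype]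
    symm
    rw [Fintype.sum_equiv (Equiv.subtypeProdEquivSigmaSubtype
      (fun c (x : 𝓞 K) => x ∈ (𝔞 c : Ideal (𝓞 K)) ∧
        Ideal.absNorm (Ideal.span {x}) = n * Ideal.absNorm (𝔞 c : Ideal (𝓞 K))))
      (fun p : D => h p.1.1 p.1.2)
      (fun s : (Σ c : ClassGroup (𝓞 K), {x : 𝓞 K // x ∈ (𝔞 c : Ideal (𝓞 K)) ∧
        Ideal.absNorm (Ideal.span {x}) = n * Ideal.absNorm (𝔞 c : Ideal (𝓞 K))}) => h s.1 s.2.1)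
      (fun p => rfl), Fintype.sum_sigma]
  rw [hLHS, finsum_eq_sum_of_fintype, ← Fintype.sum_equiv (Equiv.sigmaFiberEquiv f) (fun q => h (Equiv.sigmaFiberEquiv f q).1.1 (Equiv.sigmaFiberEquiv f q).1.2) (fun p : D => h p.1.1 p.1.2) (fun q => rfl),
    Fintype.sum_sigma, Finset.mul_sum]
  refine Finset.sum_congr rfl fun J _ => ?_
  have : ∀ q : {p : D // f p = J}, h (Equiv.sigmaFiberEquiv f ⟨J, q⟩).1.1 (Equiv.sigmaFiberEquiv f ⟨J, q⟩).1.2 =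
      g (J : Ideal (𝓞 K)) := by
    intro q
    simp only [Equiv.sigmaFiberEquiv_apply]
    rw [hweight q.1, q.2]
  simp only [this, Finset.sum_const, Finset.card_univ, nsmul_eq_mul]
  rw [← Nat.card_eq_fintype_card, hfibre J]

end Summit.BirchSwinnertonDyer.BirchSwinnertonDyer.Theorems.HeckeTheta

end
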